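import Summits.MatrixMultiplication.OmegaCensus.STPPVosperSlackTwoCheckersC

/-!
# ω-census (abelian STPP census): `{(3,3,3),(3,3,4)} ⊄ ℤ₆₁` — slack-2 CASE C, the heavy pair `(Q, P) = ([0, 1, 2], [0, 3, 6, 9])` by branches (kernel computations)

HONEST FRAMING (pub-omega census; verbatim): lottery ticket; floor = certified bounds/negative ranges.
Census STRUCTURE (seat pub-omega-stpp-2 gen 27, 2026-08-28), family (b2).  One `(Q, P)` pair of the case-C rows for `{(3,3,3),(3,3,4)} @ ℤ₆₁`
(checker `caseCDeadQP' 61 3 9 9 3 3 3`, stpp-1's `STPPVosperSlackTwoCheckersC.lean`) whose pattern `P + Q` is an interval of `ℤ/61`: 351 admissible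
tilings, python cost mirror ≈ 2.1·10⁶ steps ≈ 250 s of kernel — above the default-heartbeat ceiling of one `decide`.  The outer tiling loop is therefore
PEELED branch by branch (`tilesAll_transMasks_drop`: the loop on the translates from position `j` = the `j`-branch `&&` the loop from `j + 1`), and the
branches are decided in groups (thresholds [34, 29, 23, 18, 15, 13, 12, 1]; each ≤ 0.45·10⁶ mirror steps); `rowsC61_P11` then re-assembles
`caseCDeadQP' 61 3 9 9 3 3 3 [0, 1, 2] [0, 3, 6, 9] = true`, and `rowsC61_i11` is the `P`-index-`11` chunk in the form the assembly consumes (the two other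
`Q`-shapes are instant).  Nothing here is progress on `ω`.

References: H. Cohn, R. Kleinberg, B. Szegedy, C. Umans, FOCS 2005 (arXiv:math/0511460), Def. 5.1; Y. O. Hamidoune, Ø. J. Rødseth, Acta Arith. 92 (2000).
-/

namespace Summit.MatrixMultiplication.OmegaCensus.CubeNB.S2

open Summit.MatrixMultiplication.OmegaCensus.CubeNB.Bits

/-- `transMasks` exposes its `j`-th entry: `(transMasks p patt).drop j = (j, mask of j − patt) :: (transMasks p patt).drop (j + 1)` (`j < p`). [folklore] -/
theorem transMasks_drop_eq_cons (p : ℕ) (patt : List ℕ) {j : ℕ} (hj : j < p) :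
    (transMasks p patt).drop j = (j, maskOf (patt.map fun y => (j + p - y) % p)) :: (transMasks p patt).drop (j + 1) := by
  unfold transMasks
  rw [← List.map_drop, ← List.map_drop, List.drop_eq_getElem_cons (show j < (List.range p).length by simpa using hj),
    List.getElem_range, List.map_cons]

/-- **One branch of the tiling loop peeled off**: with the translate list exposed at position `j`, `tilesAll leaf (k+1)` on the tail from `j` is the
`j`-branch (translate `j` chosen if disjoint from the cover) conjoined with the loop on the tail from `j + 1`.  Used to split one heavy `decide` into
several. [folklore] -/
theorem tilesAll_transMasks_drop (leaf : List ℕ → ℕ → Bool) (p : ℕ) (patt : List ℕ) (k : ℕ) {j : ℕ} (hj : j < p) (ch : List ℕ) (cov : ℕ) :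
    tilesAll leaf (k + 1) ((transMasks p patt).drop j) ch cov =
      ((cond (disjB (maskOf (patt.map fun y => (j + p - y) % p)) cov)
          (tilesAll leaf k ((transMasks p patt).drop (j + 1)) (ch ++ [j]) (cov ||| maskOf (patt.map fun y => (j + p - y) % p))) true) &&
        tilesAll leaf (k + 1) ((transMasks p patt).drop (j + 1)) ch cov) := by
  rw [transMasks_drop_eq_cons p patt hj]
  rfl

/-- Branches `j ≥ 34` of the tiling loop for `(Q, P) = ([0, 1, 2], [0, 3, 6, 9])`, in one `decide`. [folklore] -/
theorem rowsC61_P11_m34 : tilesAll (caseCLeaf 61 9 9 3 3 3 [0, 1, 2] [0, 3, 6, 9]) 2 ((transMasks 61 (pattPQ 61 [0, 3, 6, 9] [0, 1, 2])).drop 34) [0] ((transMasks 61 (pattPQ 61 [0, 3, 6, 9] [0, 1, 2])).headD (0, 0)).2 = true := by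
  decide +kernel

/-- Branches `j ≥ 29` of the tiling loop for `(Q, P) = ([0, 1, 2], [0, 3, 6, 9])`: branches `29 ≤ j < 34` decided one by one, then `rowsC61_P11_m34`. [folklore] -/
theorem rowsC61_P11_m29 : tilesAll (caseCLeaf 61 9 9 3 3 3 [0, 1, 2] [0, 3, 6, 9]) 2 ((transMasks 61 (pattPQ 61 [0, 3, 6, 9] [0, 1, 2])).drop 29) [0] ((transMasks 61 (pattPQ 61 [0, 3, 6, 9] [0, 1, 2])).headD (0, 0)).2 = true := by
  rw [tilesAll_transMasks_drop _ 61 _ 1 (show 29 < 61 by decide), Bool.and_eq_true]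
  refine ⟨by decide +kernel, ?_⟩
  rw [tilesAll_transMasks_drop _ 61 _ 1 (show 30 < 61 by decide), Bool.and_eq_true]
  refine ⟨by decide +kernel, ?_⟩
  rw [tilesAll_transMasks_drop _ 61 _ 1 (show 31 < 61 by decide), Bool.and_eq_true]
  refine ⟨by decide +kernel, ?_⟩
  rw [tilesAll_transMasks_drop _ 61 _ 1 (show 32 < 61 by decide), Bool.and_eq_true]
  refine ⟨by decide +kernel, ?_⟩
  rw [tilesAll_transMasks_drop _ 61 _ 1 (show 33 < 61 by decide), Bool.and_eq_true]
  refine ⟨by decide +kernel, ?_⟩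
  exact rowsC61_P11_m34

/-- Branches `j ≥ 23` of the tiling loop for `(Q, P) = ([0, 1, 2], [0, 3, 6, 9])`: branches `23 ≤ j < 29` decided one by one, then `rowsC61_P11_m29`. [folklore] -/
theorem rowsC61_P11_m23 : tilesAll (caseCLeaf 61 9 9 3 3 3 [0, 1, 2] [0, 3, 6, 9]) 2 ((transMasks 61 (pattPQ 61 [0, 3, 6, 9] [0, 1, 2])).drop 23) [0] ((transMasks 61 (pattPQ 61 [0, 3, 6, 9] [0, 1, 2])).headD (0, 0)).2 = true := by
  rw [tilesAll_transMasks_drop _ 61 _ 1 (show 23 < 61 by decide), Bool.and_eq_true]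
  refine ⟨by decide +kernel, ?_⟩
  rw [tilesAll_transMasks_drop _ 61 _ 1 (show 24 < 61 by decide), Bool.and_eq_true]
  refine ⟨by decide +kernel, ?_⟩
  rw [tilesAll_transMasks_drop _ 61 _ 1 (show 25 < 61 by decide), Bool.and_eq_true]
  refine ⟨by decide +kernel, ?_⟩
  rw [tilesAll_transMasks_drop _ 61 _ 1 (show 26 < 61 by decide), Bool.and_eq_true]
  refine ⟨by decide +kernel, ?_⟩
  rw [tilesAll_transMasks_drop _ 61 _ 1 (show 27 < 61 by decide), Bool.and_eq_true]
  refine ⟨by decide +kernel, ?_⟩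
  rw [tilesAll_transMasks_drop _ 61 _ 1 (show 28 < 61 by decide), Bool.and_eq_true]
  refine ⟨by decide +kernel, ?_⟩
  exact rowsC61_P11_m29

/-- Branches `j ≥ 18` of the tiling loop for `(Q, P) = ([0, 1, 2], [0, 3, 6, 9])`: branches `18 ≤ j < 23` decided one by one, then `rowsC61_P11_m23`. [folklore] -/
theorem rowsC61_P11_m18 : tilesAll (caseCLeaf 61 9 9 3 3 3 [0, 1, 2] [0, 3, 6, 9]) 2 ((transMasks 61 (pattPQ 61 [0, 3, 6, 9] [0, 1, 2])).drop 18) [0] ((transMasks 61 (pattPQ 61 [0, 3, 6, 9] [0, 1, 2])).headD (0, 0)).2 = true := by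
  rw [tilesAll_transMasks_drop _ 61 _ 1 (show 18 < 61 by decide), Bool.and_eq_true]
  refine ⟨by decide +kernel, ?_⟩
  rw [tilesAll_transMasks_drop _ 61 _ 1 (show 19 < 61 by decide), Bool.and_eq_true]
  refine ⟨by decide +kernel, ?_⟩
  rw [tilesAll_transMasks_drop _ 61 _ 1 (show 20 < 61 by decide), Bool.and_eq_true]
  refine ⟨by decide +kernel, ?_⟩
  rw [tilesAll_transMasks_drop _ 61 _ 1 (show 21 < 61 by decide), Bool.and_eq_true]
  refine ⟨by decide +kernel, ?_⟩
  rw [tilesAll_transMasks_drop _ 61 _ 1 (show 22 < 61 by decide), Bool.and_eq_true]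
  refine ⟨by decide +kernel, ?_⟩
  exact rowsC61_P11_m23

/-- Branches `j ≥ 15` of the tiling loop for `(Q, P) = ([0, 1, 2], [0, 3, 6, 9])`: branches `15 ≤ j < 18` decided one by one, then `rowsC61_P11_m18`. [folklore] -/
theorem rowsC61_P11_m15 : tilesAll (caseCLeaf 61 9 9 3 3 3 [0, 1, 2] [0, 3, 6, 9]) 2 ((transMasks 61 (pattPQ 61 [0, 3, 6, 9] [0, 1, 2])).drop 15) [0] ((transMasks 61 (pattPQ 61 [0, 3, 6, 9] [0, 1, 2])).headD (0, 0)).2 = true := by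
  rw [tilesAll_transMasks_drop _ 61 _ 1 (show 15 < 61 by decide), Bool.and_eq_true]
  refine ⟨by decide +kernel, ?_⟩
  rw [tilesAll_transMasks_drop _ 61 _ 1 (show 16 < 61 by decide), Bool.and_eq_true]
  refine ⟨by decide +kernel, ?_⟩
  rw [tilesAll_transMasks_drop _ 61 _ 1 (show 17 < 61 by decide), Bool.and_eq_true]
  refine ⟨by decide +kernel, ?_⟩
  exact rowsC61_P11_m18

/-- Branches `j ≥ 13` of the tiling loop for `(Q, P) = ([0, 1, 2], [0, 3, 6, 9])`: branches `13 ≤ j < 15` decided one by one, then `rowsC61_P11_m15`. [folklore] -/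
theorem rowsC61_P11_m13 : tilesAll (caseCLeaf 61 9 9 3 3 3 [0, 1, 2] [0, 3, 6, 9]) 2 ((transMasks 61 (pattPQ 61 [0, 3, 6, 9] [0, 1, 2])).drop 13) [0] ((transMasks 61 (pattPQ 61 [0, 3, 6, 9] [0, 1, 2])).headD (0, 0)).2 = true := by
  rw [tilesAll_transMasks_drop _ 61 _ 1 (show 13 < 61 by decide), Bool.and_eq_true]
  refine ⟨by decide +kernel, ?_⟩
  rw [tilesAll_transMasks_drop _ 61 _ 1 (show 14 < 61 by decide), Bool.and_eq_true]
  refine ⟨by decide +kernel, ?_⟩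
  exact rowsC61_P11_m15

/-- Branches `j ≥ 12` of the tiling loop for `(Q, P) = ([0, 1, 2], [0, 3, 6, 9])`: branches `12 ≤ j < 13` decided one by one, then `rowsC61_P11_m13`. [folklore] -/
theorem rowsC61_P11_m12 : tilesAll (caseCLeaf 61 9 9 3 3 3 [0, 1, 2] [0, 3, 6, 9]) 2 ((transMasks 61 (pattPQ 61 [0, 3, 6, 9] [0, 1, 2])).drop 12) [0] ((transMasks 61 (pattPQ 61 [0, 3, 6, 9] [0, 1, 2])).headD (0, 0)).2 = true := by
  rw [tilesAll_transMasks_drop _ 61 _ 1 (show 12 < 61 by decide), Bool.and_eq_true]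
  refine ⟨by decide +kernel, ?_⟩
  exact rowsC61_P11_m13

/-- Branches `j ≥ 1` of the tiling loop for `(Q, P) = ([0, 1, 2], [0, 3, 6, 9])`: branches `1 ≤ j < 12` decided one by one, then `rowsC61_P11_m12`. [folklore] -/
theorem rowsC61_P11_m1 : tilesAll (caseCLeaf 61 9 9 3 3 3 [0, 1, 2] [0, 3, 6, 9]) 2 ((transMasks 61 (pattPQ 61 [0, 3, 6, 9] [0, 1, 2])).drop 1) [0] ((transMasks 61 (pattPQ 61 [0, 3, 6, 9] [0, 1, 2])).headD (0, 0)).2 = true := by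
  rw [tilesAll_transMasks_drop _ 61 _ 1 (show 1 < 61 by decide), Bool.and_eq_true]
  refine ⟨by decide +kernel, ?_⟩
  rw [tilesAll_transMasks_drop _ 61 _ 1 (show 2 < 61 by decide), Bool.and_eq_true]
  refine ⟨by decide +kernel, ?_⟩
  rw [tilesAll_transMasks_drop _ 61 _ 1 (show 3 < 61 by decide), Bool.and_eq_true]
  refine ⟨by decide +kernel, ?_⟩
  rw [tilesAll_transMasks_drop _ 61 _ 1 (show 4 < 61 by decide), Bool.and_eq_true]
  refine ⟨by decide +kernel, ?_⟩
  rw [tilesAll_transMasks_drop _ 61 _ 1 (show 5 < 61 by decide), Bool.and_eq_true]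
  refine ⟨by decide +kernel, ?_⟩
  rw [tilesAll_transMasks_drop _ 61 _ 1 (show 6 < 61 by decide), Bool.and_eq_true]
  refine ⟨by decide +kernel, ?_⟩
  rw [tilesAll_transMasks_drop _ 61 _ 1 (show 7 < 61 by decide), Bool.and_eq_true]
  refine ⟨by decide +kernel, ?_⟩
  rw [tilesAll_transMasks_drop _ 61 _ 1 (show 8 < 61 by decide), Bool.and_eq_true]
  refine ⟨by decide +kernel, ?_⟩
  rw [tilesAll_transMasks_drop _ 61 _ 1 (show 9 < 61 by decide), Bool.and_eq_true]
  refine ⟨by decide +kernel, ?_⟩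
  rw [tilesAll_transMasks_drop _ 61 _ 1 (show 10 < 61 by decide), Bool.and_eq_true]
  refine ⟨by decide +kernel, ?_⟩
  rw [tilesAll_transMasks_drop _ 61 _ 1 (show 11 < 61 by decide), Bool.and_eq_true]
  refine ⟨by decide +kernel, ?_⟩
  exact rowsC61_P11_m12

/-- **The heavy case-C pair is dead**: `caseCDeadQP' 61 3 9 9 3 3 3 [0, 1, 2] [0, 3, 6, 9] = true`. [cite: CohnKleinbergSzegedyUmans2005, Def. 5.1] -/
theorem rowsC61_P11 : caseCDeadQP' 61 3 9 9 3 3 3 [0, 1, 2] [0, 3, 6, 9] = true := by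
  unfold caseCDeadQP'
  simp only [show (3 : ℕ) - 1 = 2 from rfl]
  rw [Bool.or_eq_true]
  exact Or.inr rowsC61_P11_m1

/-- The pair `(Q, P) = ([0, 2, 3], [0, 3, 6, 9])` (holed `Q`): one `decide`. [folklore] -/
theorem rowsC61_P11_q023 : caseCDeadQP' 61 3 9 9 3 3 3 [0, 2, 3] [0, 3, 6, 9] = true := by
  decide +kernel

/-- The pair `(Q, P) = ([0, 1, 3], [0, 3, 6, 9])` (holed `Q`): one `decide`. [folklore] -/
theorem rowsC61_P11_q013 : caseCDeadQP' 61 3 9 9 3 3 3 [0, 1, 3] [0, 3, 6, 9] = true := by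
  decide +kernel

/-- The `P`-index-`11` chunk of the case-C rows (all three `Q`-shapes), in the form the assembly consumes. [folklore] -/
theorem rowsC61_i11 : ((((pShapesC 61 4).drop 11).take 1).all fun P => (qShapesC 3).all fun Q => caseCDeadQP' 61 3 9 9 3 3 3 Q P) = true := by
  rw [show ((pShapesC 61 4).drop 11).take 1 = [[0, 3, 6, 9]] from by decide, show qShapesC 3 = [[0, 2, 3], [0, 1, 3], [0, 1, 2]] from by decide]
  simp only [List.all_cons, List.all_nil, Bool.and_true, Bool.and_eq_true]
  exact ⟨rowsC61_P11_q023, rowsC61_P11_q013, rowsC61_P11⟩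

end Summit.MatrixMultiplication.OmegaCensus.CubeNB.S2
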